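import Summits.BirchSwinnertonDyer.Rank1Residual.X12.O11.RamifiedStrictDescentAtThreeLocal
import Summits.BirchSwinnertonDyer.Rank1Residual.X11b.BDPRouteControlStrictPlace
import Summits.BirchSwinnertonDyer.Rank1Residual.X11b.BDPRouteNonsingularTorsionDivisible
import Summits.BirchSwinnertonDyer.Rank1Residual.X11b.AnticyclotomicLocalKernelTrivial
import HarnessLib

/-!
# O11 at `p = 3`, companion V — EXACT control with the DEFECT DISPLAYED: at a `3`-frame with (A𝔭)₃,
# `#Sel_𝔭(K^ac_∞, W[3^∞])^Γ = #Sel_𝔭(K, W[3^∞]) · d`, where `d` is the order of the image of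
# Greenberg's `A = res⁻¹(Sel_𝔭(K_∞, W[3^∞]))` in `⊕_{v ∈ T} H¹(K_v, W[3^∞])` — a subgroup of
# `⊕_{v ∈ T} ker r_v`, so `d ≤ 3^{Σ_{v ∈ T₀} ord₃ c_v(W_K)}` — regime V of route `PrintCFram`
# (item stmt-BirchSwinnertonDyer-20700; cell `bsd-print-cfram`, D-0131 (2), typer `ty2` gen 2, (γ′))

HONEST FRAMING (cell `bsd-print-cfram`, HOME `run/shared/lean/pub/bsd-print-cfram/`): THEOREMS ONLY
(no definition, no named fact, no axiom, no `sorry`); nothing about BSD is booked; regime V and the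
leaf stay OPEN; beyond-print theorem: NO.

WHY (PLAN v2 §2 ty2 (γ); lit DOSSIER v6 §32; REF R0.12). On regime V the one-sided control of
companion IV (`RamifiedStrictDescentAtThreeTamagawa.lean`) bounds the control defect by
`∏ c_v^{(3)}`; the EXACT defect is not `∏ c_v^{(3)}` («Poitou–Tate surjectivity at S_V» is false at a
rank-one frame: the dual structure is relaxed at `𝔭`, of `ℤ₃`-rank 2) but the order of
`(⊕_{v ∈ T} ker r_v) ∩ im(loc_T |_A)`. This file proves the exact identity with that group DISPLAYED
as a kernel quantity — no surjectivity binder, no vacuity trap: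

* §1 (generic: any elliptic curve `E` over a totally complex `K`, any `p`, `κ` with generator `γ`,
  `𝔭`, `Σ`, finite `T ∋ 𝔭` off which the away conditions descend, `H¹(K, E[p^∞]) ↪ H¹(K_∞, E[p^∞])`):
  `natCard_invariants_eq_natCard_selmerAcBase_mul_natCard_range` —
  `#Sel^γ = #Sel_𝔭^Σ(K, E[p^∞]) · #im(ψ_T|_A)` with `ψ_T = loc_T` (`AcSelmer.locAtFinset`),
  `A = AcSelmer.selmerAcPreimage`, and `#im(ψ_T|_A) ≤ ∏_{v ∈ T} #ker r_v`. Proof = X11b's counting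
  snake lemma (`finite_endInvariants_and_natCard_le_of_localKer_strict`, cell b2b-bsdres) with its two
  inequalities replaced by the equalities they come from: `ker(ψ_T|_A) = Sel_𝔭^Σ(K)` EXACTLY
  (`mem_selmerAcBase_iff_locAtFinset_eq_zero_strict` + `selmerAcBase_le_selmerAcPreimage`) and
  `res : A → Sel^γ` BIJECTIVE (onto by Lemma 3.2 `exists_mem_selmerAcPreimage_resOfLe_eq`, injective
  by `hinj`).
* §2 at a `3`-frame (`K = ℚ(√−3)`), anticyclotomic `κ`: `natCard_invariants_eq_mul_defect_of_isFrameThree`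
  — with `W(K_𝔭)[3] = 0` ((A𝔭)₃: injectivity by `fixedPoints_kerSubgroup_eq_bot_of_noPTorsion`,
  `ker r_𝔭 = 0`) and (Av)₃ demanded only OFF a finite `T₀ ∌ 𝔭` of places `v ∤ 3`:
  `#Sel^γ = #Sel_𝔭(K, W[3^∞]) · d` and `d ≤ 3^{Σ_{v ∈ T₀} ord₃ c_v(W_K)}`, `d` the order of the
  image of `A` under `loc_{{𝔭} ∪ T₀}` (its `𝔭`-component vanishes); and with the `ℚ₃`-binders + (D♮)₃:
  `natCard_invariants_eq_strictSelmer_mul_defect_of_isFrameThree`: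
  `#Sel^γ = #Sel_str(W)[3^∞] · #Sel_str(W')[3^∞] · d`.
So on regime V the corrected (R-ctrl)₃♯ reads «`n₀ + log₃ #X[T] = log₃ #Sel_str(W) + log₃ #Sel_str(W')
+ log₃ d`» with `d` a DISPLAYED finite invariant of the frame (lit §32: `d = 3^{#S_V − t}`, `t` the
number of the two Mordell–Weil generators off the identity component at the V-places; `t = 1` on all
20 rungs `N < 5·10⁵`, kit j284290 / REF S24) — a certificate field, like `n, n'`. Nothing asserted.

References: [GreenbergLNM1716] §3 Lemmas 3.1–3.3, pp. 85–87, 90, §4 Lemma 4.7 / Prop. 4.13 (the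
global-to-local cokernel); [JetchevSkinnerWan2017] §3.3 (shape); [Castella2018] Def. 2.2, Thm. 2.3;
[MilneADT2006] Thm. I.4.10 (Poitou–Tate: the cokernel is dual to a compact Selmer group); tree: X11b
`BDPRouteControlSnake.lean`, `BDPRouteControlStrictPlace.lean`, `AnticyclotomicControlMap.lean`,
`AnticyclotomicRestrictionInjective.lean`; companion IV; HOME/DOSSIER.md §32; HOME/TY2-DISCHARGE-TABLE.md §D.
-/

noncomputable section

open scoped Classical

open WeierstrassCurve NumberField IsDedekindDomain Field
  Literature.NumberTheory.EllipticCurves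
  Literature.NumberTheory.EllipticCurves.GreenbergSelmer
  Literature.NumberTheory.EllipticCurves.Rank1Residual
  Literature.NumberTheory.GaloisRepresentations
  Summit.BirchSwinnertonDyer.Rank1Residual
  Summit.BirchSwinnertonDyer.Rank1Residual.Additive
  Summit.BirchSwinnertonDyer.Rank1Residual.X11b
  Summit.BirchSwinnertonDyer.Rank1Residual.X11b.AcSelmer
  Summit.BirchSwinnertonDyer.BirchSwinnertonDyer.Theorems

namespace Summit.BirchSwinnertonDyer.Rank1Residual.X12.O11

/-! ## §1 Generic: exact control with the localisation image displayed -/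

section Generic

variable {K : Type} [Field K] [NumberField K]
variable {E : WeierstrassCurve K} {p : ℕ} [Fact p.Prime] {κ : ZpExtension K p}
  {𝔭 : HeightOneSpectrum (𝓞 K)} {S : Set (HeightOneSpectrum (𝓞 K))}

/-- **EXACT control with the defect displayed (Greenberg §3, JSW §3.3).** For `E` over a totally
complex `K`, `κ` with topological generator `γ`, `𝔭`, `Σ`, a finite set `T ∋ 𝔭` of finite places
(all `∉ Σ`, apart from `𝔭` not above `p`) off which the away conditions descend, `ker r_v` finite on
`T`, `Sel_𝔭^Σ(K, E[p^∞])` finite, and `H¹(K, E[p^∞]) → H¹(K_∞, E[p^∞])` INJECTIVE (`hinj`): then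
`Sel^γ = H⁰(⟨γ⟩, Sel_𝔭^Σ(K_∞, E[p^∞]))` is finite,
`#Sel^γ = #Sel_𝔭^Σ(K, E[p^∞]) · #im(ψ_T|_A)` and `#im(ψ_T|_A) ≤ ∏_{v ∈ T} #ker r_v`, where
`A = res⁻¹(Sel_𝔭^Σ(K_∞, E[p^∞]))` (`selmerAcPreimage`) and `ψ_T = loc_T` (`locAtFinset`): `res : A → Sel^γ`
is a bijection (Lemma 3.2 + `hinj`), `ker(ψ_T|_A) = Sel_𝔭^Σ(K)` and `im(ψ_T|_A) ⊆ ⊕_{v ∈ T} ker r_v`.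
The group `im(ψ_T|_A)` is Greenberg's global-to-local term (his Lemma 4.7 / Prop. 4.13 describe it by
Poitou–Tate); here it is displayed, not evaluated. [cite: GreenbergLNM1716, §3 pp. 85–86, 90 and §4 Lemma 4.7, Prop. 4.13]
[cite: JetchevSkinnerWan2017, §3.3 and Thm. 3.3.1 (control; shape only)] -/
theorem natCard_invariants_eq_natCard_selmerAcBase_mul_natCard_range [IsTotallyComplex K]
    {γ : absoluteGaloisGroup K} (hγ : κ.IsTopGenerator γ)
    (T : Finset (HeightOneSpectrum (𝓞 K))) (h𝔭T : 𝔭 ∈ T)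
    (hTp : ∀ v ∈ T, v ≠ 𝔭 → ((p : ℕ) : 𝓞 K) ∉ v.asIdeal) (hTS : ∀ v ∈ T, v ∉ S)
    (hS : ∀ c : E.subgroupH1 p (⊤ : Subgroup (absoluteGaloisGroup K)),
      E.resOfLe p (le_top : κ.kerSubgroup ≤ ⊤) c ∈ selmerAc E p κ 𝔭 S →
        ∀ v : HeightOneSpectrum (𝓞 K), ((p : ℕ) : 𝓞 K) ∉ v.asIdeal → v ∉ S → v ∉ T →
          c ∈ awayKer ⊤ (E.geomPrimaryTorsion p) v)
    (hinj : Function.Injective (ResKernel.resSubgroup κ.kerSubgroup (E.geomPrimaryTorsion p)))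
    [Finite (selmerAcBase E p 𝔭 S)]
    (hfin : ∀ v ∈ T, Finite (localKer κ.kerSubgroup (E.geomPrimaryTorsion p) v)) :
    Finite (IwasawaDual.endInvariants (conjSelmerAc E p κ 𝔭 S γ - 1)) ∧
      Nat.card (IwasawaDual.endInvariants (conjSelmerAc E p κ 𝔭 S γ - 1)) =
        Nat.card (selmerAcBase E p 𝔭 S) *
          Nat.card ((locAtFinset E p T).comp (selmerAcPreimage E p κ 𝔭 S).subtype).range ∧
      Nat.card ((locAtFinset E p T).comp (selmerAcPreimage E p κ 𝔭 S).subtype).range ≤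
        ∏ v ∈ T, Nat.card (localKer κ.kerSubgroup (E.geomPrimaryTorsion p) v) := by
  set A := selmerAcPreimage E p κ 𝔭 S
  set ψ : A →+ Π v : T, subgroupH1 ((⊤ : Subgroup (absoluteGaloisGroup K)) ⊓
      decomp (v : HeightOneSpectrum (𝓞 K))) (E.geomPrimaryTorsion p) :=
    (locAtFinset E p T).comp A.subtype with hψ
  -- (1) the image lies in `∏ ker r_v`
  have hrange : ∀ (a : A) (v : T), ψ a v ∈ localKer κ.kerSubgroup (E.geomPrimaryTorsion p) v :=
    fun a v ↦ resOfLe_mem_localKer_of_mem_selmerAcPreimage_strict hTp hTS a.2 v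
  -- (2) the kernel is `Sel_𝔭^Σ(K, E[p^∞])`
  have hker : ∀ a : A, a ∈ ψ.ker ↔ (a : E.subgroupH1 p ⊤) ∈ selmerAcBase E p 𝔭 S := by
    intro a
    rw [AddMonoidHom.mem_ker, mem_selmerAcBase_iff_locAtFinset_eq_zero_strict h𝔭T hTp hTS hS a.2]
    rfl
  -- (3) finiteness and count of `im ψ`
  haveI hfinT : ∀ v : T, Finite (localKer κ.kerSubgroup (E.geomPrimaryTorsion p)
      (v : HeightOneSpectrum (𝓞 K))) := fun v ↦ hfin v v.2
  let e : ψ.range → Π v : T, localKer κ.kerSubgroup (E.geomPrimaryTorsion p)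
      (v : HeightOneSpectrum (𝓞 K)) :=
    fun y ↦ fun v ↦ ⟨y.1 v, by
      obtain ⟨a, ha⟩ := y.2
      rw [← ha]
      exact hrange a v⟩
  have he : Function.Injective e := by
    intro y₁ y₂ h
    apply Subtype.ext
    funext v
    simpa [e] using congrArg Subtype.val (congr_fun h v)
  haveI : Finite ψ.range := Finite.of_injective e he
  have hcard_range : Nat.card ψ.range ≤
      ∏ v ∈ T, Nat.card (localKer κ.kerSubgroup (E.geomPrimaryTorsion p) v) := by
    calc Nat.card ψ.range
        ≤ Nat.card (Π v : T, localKer κ.kerSubgroup (E.geomPrimaryTorsion p)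
            (v : HeightOneSpectrum (𝓞 K))) := Nat.card_le_card_of_injective e he
      _ = ∏ v : T, Nat.card (localKer κ.kerSubgroup (E.geomPrimaryTorsion p)
            (v : HeightOneSpectrum (𝓞 K))) := Nat.card_pi
      _ = ∏ v ∈ T, Nat.card (localKer κ.kerSubgroup (E.geomPrimaryTorsion p) v) :=
          Finset.prod_coe_sort T fun v ↦
            Nat.card (localKer κ.kerSubgroup (E.geomPrimaryTorsion p) v)
  -- (4) `ker ψ ≃ Sel_𝔭^Σ(K, E[p^∞])`, exactly
  let f : ψ.ker → selmerAcBase E p 𝔭 S := fun a ↦ ⟨((a : A) : E.subgroupH1 p ⊤), (hker a).mp a.2⟩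
  have hf : Function.Bijective f := by
    refine ⟨fun a₁ a₂ h ↦ ?_, fun b ↦ ?_⟩
    · apply Subtype.ext; apply Subtype.ext
      simpa [f] using congrArg (fun x : selmerAcBase E p 𝔭 S ↦ (x : E.subgroupH1 p ⊤)) h
    · refine ⟨⟨⟨(b : E.subgroupH1 p ⊤), selmerAcBase_le_selmerAcPreimage b.2⟩, (hker _).mpr b.2⟩, ?_⟩
      rfl
  haveI : Finite ψ.ker := Finite.of_injective f hf.1
  have hcard_ker : Nat.card ψ.ker = Nat.card (selmerAcBase E p 𝔭 S) :=
    Nat.card_congr (Equiv.ofBijective f hf)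
  -- (5) `A` is finite and `#A = #Sel(K) · #im ψ`
  haveI : Finite (A ⧸ ψ.ker) :=
    Finite.of_equiv _ (QuotientAddGroup.quotientKerEquivRange ψ).toEquiv.symm
  haveI hAfin : Finite A :=
    Finite.of_equiv _ (AddSubgroup.addGroupEquivQuotientProdAddSubgroup (s := ψ.ker)).symm
  have hcardA : Nat.card A = Nat.card (selmerAcBase E p 𝔭 S) * Nat.card ψ.range := by
    rw [AddSubgroup.card_eq_card_quotient_mul_card_addSubgroup ψ.ker,
      Nat.card_congr (QuotientAddGroup.quotientKerEquivRange ψ).toEquiv, mul_comm, hcard_ker]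
  -- (6) `res : A → Sel^γ` is a bijection
  let g : A → IwasawaDual.endInvariants (conjSelmerAc E p κ 𝔭 S γ - 1) := fun a ↦
    ⟨⟨E.resOfLe p (le_top : κ.kerSubgroup ≤ ⊤) (a : E.subgroupH1 p ⊤),
        (mem_selmerAcPreimage_iff _).mp a.2⟩, by
      rw [IwasawaDual.mem_endInvariants_iff, IwasawaDual.End_sub_apply, AddMonoid.End.one_apply,
        sub_eq_zero]
      exact Subtype.ext (conjH1_resOfLe_top γ (a : E.subgroupH1 p ⊤))⟩
  have hg : Function.Bijective g := by
    refine ⟨fun a b hab ↦ ?_, fun x ↦ ?_⟩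
    · have h : E.resOfLe p (le_top : κ.kerSubgroup ≤ ⊤) (a : E.subgroupH1 p ⊤) =
          E.resOfLe p (le_top : κ.kerSubgroup ≤ ⊤) (b : E.subgroupH1 p ⊤) := by
        simpa [g] using congrArg (fun y : IwasawaDual.endInvariants (conjSelmerAc E p κ 𝔭 S γ - 1) ↦
          ((y : selmerAc E p κ 𝔭 S) : E.subgroupH1 p κ.kerSubgroup)) hab
      exact Subtype.ext (resOfLe_top_injective_of hinj h)
    · obtain ⟨c, hcA, hc⟩ := exists_mem_selmerAcPreimage_resOfLe_eq hγ x
      exact ⟨⟨c, hcA⟩, Subtype.ext (Subtype.ext hc)⟩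
  have hcardγ : Nat.card (IwasawaDual.endInvariants (conjSelmerAc E p κ 𝔭 S γ - 1)) = Nat.card A :=
    (Nat.card_congr (Equiv.ofBijective g hg)).symm
  exact ⟨Finite.of_surjective g hg.2, by rw [hcardγ, hcardA], hcard_range⟩

end Generic

/-! ## §2 At a `3`-frame: the defect on a finite set `T₀` of places `v ∤ 3`, (A𝔭)₃ only -/

section FrameThree

variable {W : WeierstrassCurve ℚ} [W.IsElliptic] {K : Type} [Field K] [NumberField K]
  {𝔭 : HeightOneSpectrum (𝓞 K)} {W' : WeierstrassCurve ℚ} {C : VariableChange ℚ}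

/-- **EXACT control with the defect displayed at a `3`-frame (regimes N ∪ V).** At a `3`-frame
`(K, 𝔭, W', C)` of `W`, for every anticyclotomic `ℤ₃`-extension `κ` with topological generator `γ`,
granted `W(K_𝔭)[3] = 0` ((A𝔭)₃) and a finite set `T₀` of places `v ∤ 3` of `K` such that (Av)₃ holds
at every degree-one `v ∤ 3` OUTSIDE `T₀`: if `Sel_𝔭(K, W[3^∞])` is finite then `Sel^γ` is finite,
`#Sel^γ = #Sel_𝔭(K, W[3^∞]) · d` and `d ≤ 3^{Σ_{v ∈ T₀} ord₃ c_v(W_K)}`, where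
`d = #im(loc_{{𝔭} ∪ T₀} |_A)` is the order of the image of `A = res⁻¹(Sel_𝔭(K_∞, W[3^∞]))` in
`⊕_{v ∈ {𝔭} ∪ T₀} H¹(K_v, W[3^∞])` (its `𝔭`-component is zero: `ker r_𝔭 = 0`). §1 with
`T = {𝔭} ∪ T₀`, injectivity from (A𝔭)₃ (`fixedPoints_kerSubgroup_eq_bot_of_noPTorsion`), away descent
off `T` pointwise (companion IV's argument, inlined), Greenberg's Lemma 3.3 on `T₀`. On regime N
(`T₀ = ∅`) `d = 1`; on regime V `d = 3^{#S_V − t}` in lit DOSSIER §32's notation — DISPLAYED, never a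
binder. [cite: GreenbergLNM1716, §3 Lemmas 3.1–3.3 (pp. 85–87), p. 90, §4 Prop. 4.13]
[cite: Castella2018, Def. 2.2 and Thm. 2.3 (arXiv:1704.06608 p. 5) (shape only)] -/
theorem natCard_invariants_eq_mul_defect_of_isFrameThree (hF : IsFrameThree W K 𝔭 W' C)
    (κ : ZpExtension K 3) (hκ : κ.IsAnticyclotomic) (γ : absoluteGaloisGroup K)
    [hγ : Fact (κ.IsTopGenerator γ)]
    (h𝔭 : ∀ R : ((W.baseChange K).baseChange (𝔭.adicCompletion K)).toAffine.Point,
      (3 : ℕ) • R = 0 → R = 0)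
    (T₀ : Finset (HeightOneSpectrum (𝓞 K))) (hT₀ : ∀ v ∈ T₀, ((3 : ℕ) : 𝓞 K) ∉ v.asIdeal)
    (hv : ∀ v : HeightOneSpectrum (𝓞 K), v ∉ T₀ → ((3 : ℕ) : 𝓞 K) ∉ v.asIdeal →
      v.asIdeal.ramificationIdx (𝓞 ℚ) = 1 → v.asIdeal.inertiaDeg (𝓞 ℚ) = 1 →
      (W.baseChange K).HasGoodReductionAt v ∨
        ∀ R : ((W.baseChange K).baseChange (v.adicCompletion K)).toAffine.Point,
          (3 : ℕ) • R = 0 → R = 0)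
    [Finite (selmerAcBase (W.baseChange K) 3 𝔭 ∅)] :
    Finite (IwasawaDual.endInvariants
        (Castella2018.AcSelmer.conjSelmerAc (W.baseChange K) 3 κ 𝔭 ∅ γ - 1)) ∧
      Nat.card (IwasawaDual.endInvariants
          (Castella2018.AcSelmer.conjSelmerAc (W.baseChange K) 3 κ 𝔭 ∅ γ - 1)) =
        Nat.card (selmerAcBase (W.baseChange K) 3 𝔭 ∅) *
          Nat.card ((locAtFinset (W.baseChange K) 3 (insert 𝔭 T₀)).comp
            (selmerAcPreimage (W.baseChange K) 3 κ 𝔭 ∅).subtype).range ∧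
      Nat.card ((locAtFinset (W.baseChange K) 3 (insert 𝔭 T₀)).comp
          (selmerAcPreimage (W.baseChange K) 3 κ 𝔭 ∅).subtype).range ≤
        3 ^ (∑ v ∈ T₀, padicValNat 3
          (((W.baseChange K).baseChange (v.adicCompletion K)).localTamagawaNumber
            (v.adicCompletionIntegers K))) := by
  haveI : IsTotallyComplex K := hF.2.2.1.2
  haveI hEK : (W.baseChange K).IsElliptic := by rw [baseChange]; infer_instance
  have hK2 : Module.finrank ℚ K = 2 := hF.2.2.1.1
  have h3𝔭 : ((3 : ℕ) : 𝓞 K) ∈ 𝔭.asIdeal := hF.2.2.2.2.1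
  have h𝔭T₀ : 𝔭 ∉ T₀ := fun h => hT₀ 𝔭 h h3𝔭
  have hbot : localKer κ.kerSubgroup ((W.baseChange K).geomPrimaryTorsion 3) 𝔭 = ⊥ :=
    AcSelmer.localKer_eq_bot_of_noPTorsion (W.baseChange K) 3 κ 𝔭 h𝔭
  have hinj : Function.Injective
      (ResKernel.resSubgroup κ.kerSubgroup ((W.baseChange K).geomPrimaryTorsion 3)) :=
    resSubgroup_kerSubgroup_injective_of_fixedPoints_eq_bot (W.baseChange K) 3 κ hγ.out
      (RamifiedSevenEllipticUnits.fixedPoints_kerSubgroup_eq_bot_of_noPTorsion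
        (W.baseChange K) 3 κ 𝔭 h𝔭)
  -- away descent off `{𝔭} ∪ T₀`, pointwise (companion IV's trichotomy argument)
  have hS : ∀ c : (W.baseChange K).subgroupH1 3 (⊤ : Subgroup (absoluteGaloisGroup K)),
      (W.baseChange K).resOfLe 3 (le_top : κ.kerSubgroup ≤ ⊤) c ∈
          selmerAc (W.baseChange K) 3 κ 𝔭 ∅ →
        ∀ v : HeightOneSpectrum (𝓞 K), ((3 : ℕ) : 𝓞 K) ∉ v.asIdeal → v ∉ (∅ : Set _) →
          v ∉ insert 𝔭 T₀ → c ∈ awayKer ⊤ ((W.baseChange K).geomPrimaryTorsion 3) v := by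
    intro c hc v hpv hvS hvT
    have hvT₀ : v ∉ T₀ := fun h => hvT (Finset.mem_insert_of_mem h)
    have h1 := ((mem_selmerOver_iff _).mp hc).1 v hpv hvS 1
    rw [Literature.NumberTheory.EllipticCurves.conjH1_one_holds, AddMonoidHom.id_apply] at h1
    set v₀ : HeightOneSpectrum (𝓞 ℚ) := v.under (𝓞 ℚ) with hv₀def
    rcases placesOver_trichotomy_of_finrank_eq_two K hK2 v₀ with
        ⟨w₁, w₂, -, -, hef⟩ | ⟨w, hset, -, hf⟩ | ⟨w, hset, he, -⟩
    · obtain ⟨he, hf⟩ := hef v rfl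
      rcases hv v hvT₀ hpv he hf with hgood | htors
      · exact (resOfLe_mem_awayKer_kerSubgroup_iff_of_hasGoodReductionAt (W.baseChange K) 3 κ hpv
          hgood c).mp h1
      · exact mem_awayKer_of_localKer_eq_bot hpv hvS
          (AcSelmer.localKer_eq_bot_of_noPTorsion (W.baseChange K) 3 κ v htors) hc
    · have hvw : v = w := by
        have hmem : v ∈ {w' : HeightOneSpectrum (𝓞 K) | w'.under (𝓞 ℚ) = v₀} := rfl
        rw [hset] at hmem
        exact hmem
      have hf' : v.asIdeal.inertiaDeg (𝓞 ℚ) = 2 := by rw [hvw]; exact hf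
      exact (IsAnticyclotomic.resOfLe_mem_awayKer_iff_of_inertiaDeg_eq_two hK2 hκ hpv
        (ℓ := v₀) rfl hf' c).mp h1
    · have hvw : v = w := by
        have hmem : v ∈ {w' : HeightOneSpectrum (𝓞 K) | w'.under (𝓞 ℚ) = v₀} := rfl
        rw [hset] at hmem
        exact hmem
      have he' : v.asIdeal.ramificationIdx (𝓞 ℚ) = 2 := by rw [hvw]; exact he
      exact (IsAnticyclotomic.resOfLe_mem_awayKer_iff_of_ramificationIdx_eq_two hK2 hκ hpv he'
        c).mp h1
  obtain ⟨hfin, heq, hle⟩ := natCard_invariants_eq_natCard_selmerAcBase_mul_natCard_range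
    (E := W.baseChange K) (S := (∅ : Set (HeightOneSpectrum (𝓞 K)))) hγ.out (insert 𝔭 T₀)
    (Finset.mem_insert_self 𝔭 T₀)
    (fun v hvT hne => hT₀ v ((Finset.mem_insert.mp hvT).resolve_left hne))
    (fun v _ => Set.notMem_empty v) hS hinj
    (fun v hvT => by
      rcases Finset.mem_insert.mp hvT with rfl | hvT₀
      · rw [hbot]; infer_instance
      · exact (natCard_localKer_le_pow_padicValNat_localTamagawaNumber (W.baseChange K) κ
          (hT₀ v hvT₀)).1)
  refine ⟨hfin, heq, hle.trans ?_⟩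
  rw [Finset.prod_insert h𝔭T₀, hbot, AddSubgroup.card_bot, one_mul, ← Finset.prod_pow_eq_pow_sum]
  exact Finset.prod_le_prod' fun v hvT₀ =>
    (natCard_localKer_le_pow_padicValNat_localTamagawaNumber (W.baseChange K) κ (hT₀ v hvT₀)).2

/-- **`#Sel^γ = #Sel_str(W/ℚ)[3^∞] · #Sel_str(W'/ℚ)[3^∞] · d`, `d ≤ 3^{Σ_{v ∈ T₀} ord₃ c_v(W_K)}`** at
a `3`-frame with globally minimal twin `W'`: (A𝔭)₃ from the two `ℚ₃`-binders
(`noThreeTorsion_adicCompletion_of_isFrameThree`) and the unconditional twist count (D♮)₃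
(`natCard_selmerAcBase_frameThree_eq_mul`). The corrected (R-ctrl)₃♯ of regime V in cardinality form,
with the defect `d` DISPLAYED. [cite: GreenbergLNM1716, §3 Lemma 3.3 (p. 87), p. 90, §4 Prop. 4.13]
[cite: DokchitserDokchitserAnnals2010, Lemma 4.14 (proof) (the twist decomposition)] -/
theorem natCard_invariants_eq_strictSelmer_mul_defect_of_isFrameThree [W'.IsElliptic]
    (hF : IsFrameThree W K 𝔭 W' C)
    (κ : ZpExtension K 3) (hκ : κ.IsAnticyclotomic) (γ : absoluteGaloisGroup K)
    [Fact (κ.IsTopGenerator γ)]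
    (htors : ∀ Q : (W.baseChange ℚ_[3]).toAffine.Point, (3 : ℕ) • Q = 0 → Q = 0)
    (htors' : ∀ Q : (W'.baseChange ℚ_[3]).toAffine.Point, (3 : ℕ) • Q = 0 → Q = 0)
    (T₀ : Finset (HeightOneSpectrum (𝓞 K))) (hT₀ : ∀ v ∈ T₀, ((3 : ℕ) : 𝓞 K) ∉ v.asIdeal)
    (hv : ∀ v : HeightOneSpectrum (𝓞 K), v ∉ T₀ → ((3 : ℕ) : 𝓞 K) ∉ v.asIdeal →
      v.asIdeal.ramificationIdx (𝓞 ℚ) = 1 → v.asIdeal.inertiaDeg (𝓞 ℚ) = 1 →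
      (W.baseChange K).HasGoodReductionAt v ∨
        ∀ R : ((W.baseChange K).baseChange (v.adicCompletion K)).toAffine.Point,
          (3 : ℕ) • R = 0 → R = 0)
    [Finite (selmerAcBase (W.baseChange K) 3 𝔭 ∅)] :
    Nat.card (IwasawaDual.endInvariants
        (Castella2018.AcSelmer.conjSelmerAc (W.baseChange K) 3 κ 𝔭 ∅ γ - 1)) =
      Nat.card ↥(strictSelmerPInfty W 3) * Nat.card ↥(strictSelmerPInfty W' 3) *
        Nat.card ((locAtFinset (W.baseChange K) 3 (insert 𝔭 T₀)).comp
          (selmerAcPreimage (W.baseChange K) 3 κ 𝔭 ∅).subtype).range ∧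
      Nat.card ((locAtFinset (W.baseChange K) 3 (insert 𝔭 T₀)).comp
          (selmerAcPreimage (W.baseChange K) 3 κ 𝔭 ∅).subtype).range ≤
        3 ^ (∑ v ∈ T₀, padicValNat 3
          (((W.baseChange K).baseChange (v.adicCompletion K)).localTamagawaNumber
            (v.adicCompletionIntegers K))) := by
  rw [← natCard_selmerAcBase_frameThree_eq_mul W hF]
  obtain ⟨-, heq, hle⟩ := natCard_invariants_eq_mul_defect_of_isFrameThree hF κ hκ γ
    (noThreeTorsion_adicCompletion_of_isFrameThree W hF htors htors') T₀ hT₀ hv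
  exact ⟨heq, hle⟩

end FrameThree

end Summit.BirchSwinnertonDyer.Rank1Residual.X12.O11

end
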